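import Mathlib

/-!
# T5CoveringIntegral — integrals along a covering of degree `d` (N1 §ID-5, G-ID-4)

Sub-step N1 of Tier 5 (route/T5-ID-p2.md, §ID-5 and the gap line G-ID-4 «level bookkeeping»)
applies the period statement (N) at the level `K` of the vertex Schwartz data and records the
descent to a smaller level `K′ ⊆ K` as a choice, through Lemma A7.3(c) of Tier 4: the
surface `S′ = S_{K′}` covers `S = S_K` with finite degree `d = [K : K′]` (up to the finite
component bookkeeping), and the period of the pulled-back forms on `S′` is `d` times the
period on `S` — so non-vanishing passes down the tower.

This file records the measure-theoretic identity behind that sentence. A covering of degree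
`d` is modelled by its effect on the volume measures, `Measure.map π μ′ = d • μ` (the
push-forward of the volume of `S′` is `d` times the volume of `S`); the geometric fact that
a finite étale covering of degree `d` with the invariant volume forms satisfies this is the
(cited) input and is a hypothesis here.

* `integral_comp_eq_smul` — `∫_{S′} f ∘ π dμ′ = d • ∫_S f dμ` (`integral_map`,
  `integral_smul_measure`);
* `integral_comp_ne_zero` — if `d ≠ 0` and `∫_S f dμ ≠ 0` then `∫_{S′} f ∘ π dμ′ ≠ 0`:
  a non-vanishing period at level `K` is a non-vanishing period at every smaller level;
* `integral_comp_mul_eq_smul` — the same for an integrand that is a product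
  (a density times a function pulled back);
* `exists_ne_zero_of_exists_ne_zero` — the quantified form used by (N): if some member of a
  family of integrands has non-zero period on `S`, some member has non-zero period on `S′`.

Nothing about Shimura varieties, levels or forms is formalised: `S`, `S′` are measurable
spaces, `π` a measurable map, `d` a natural number.
-/

namespace Summit.Ventures.HodgeRepro2.T5CoveringIntegral

open MeasureTheory
open scoped ENNReal

variable {S S' : Type*} [MeasurableSpace S] [MeasurableSpace S']

/-- **Integrals along a covering of degree `d`.** If the push-forward of `μ′` along `π` is
`d • μ`, then `∫ f ∘ π dμ′ = d • ∫ f dμ`. -/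
theorem integral_comp_eq_smul (μ : Measure S) (μ' : Measure S') (π : S' → S)
    (hπ : AEMeasurable π μ') (d : ℕ) (hd : Measure.map π μ' = (d : ℝ≥0∞) • μ)
    (f : S → ℂ) (hf : AEStronglyMeasurable f μ) :
    ∫ x, f (π x) ∂μ' = (d : ℂ) * ∫ x, f x ∂μ := by
  have hf' : AEStronglyMeasurable f (Measure.map π μ') := by
    rw [hd]
    exact hf.smul_measure _
  rw [← integral_map hπ hf', hd, integral_smul_measure]
  simp only [ENNReal.toReal_natCast, Complex.real_smul, Complex.ofReal_natCast]

/-- A non-vanishing period survives pull-back along a covering of positive degree. -/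
theorem integral_comp_ne_zero (μ : Measure S) (μ' : Measure S') (π : S' → S)
    (hπ : AEMeasurable π μ') (d : ℕ) (hd₀ : d ≠ 0) (hd : Measure.map π μ' = (d : ℝ≥0∞) • μ)
    (f : S → ℂ) (hf : AEStronglyMeasurable f μ) (h : ∫ x, f x ∂μ ≠ 0) :
    ∫ x, f (π x) ∂μ' ≠ 0 := by
  rw [integral_comp_eq_smul μ μ' π hπ d hd f hf]
  exact mul_ne_zero (Nat.cast_ne_zero.mpr hd₀) h

/-- The period of a pulled-back product integrand along a covering of degree `d`. -/
theorem integral_comp_mul_eq_smul (μ : Measure S) (μ' : Measure S') (π : S' → S)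
    (hπ : AEMeasurable π μ') (d : ℕ) (hd : Measure.map π μ' = (d : ℝ≥0∞) • μ)
    (f g : S → ℂ) (hf : AEStronglyMeasurable f μ) (hg : AEStronglyMeasurable g μ) :
    ∫ x, f (π x) * g (π x) ∂μ' = (d : ℂ) * ∫ x, f x * g x ∂μ :=
  integral_comp_eq_smul μ μ' π hπ d hd (fun x => f x * g x) (hf.mul hg)

/-- **The quantified form.** If some member `f i` of a family of integrands has a non-zero
period on `S`, then some member has a non-zero period on the covering `S′` (the same index,
with the pulled-back integrand) — the shape in which (N) descends the tower of levels. -/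
theorem exists_ne_zero_of_exists_ne_zero {ι : Type*} (μ : Measure S) (μ' : Measure S')
    (π : S' → S) (hπ : AEMeasurable π μ') (d : ℕ) (hd₀ : d ≠ 0)
    (hd : Measure.map π μ' = (d : ℝ≥0∞) • μ) (f : ι → S → ℂ)
    (hf : ∀ i, AEStronglyMeasurable (f i) μ) (h : ∃ i, ∫ x, f i x ∂μ ≠ 0) :
    ∃ i, ∫ x, f i (π x) ∂μ' ≠ 0 := by
  obtain ⟨i, hi⟩ := h
  exact ⟨i, integral_comp_ne_zero μ μ' π hπ d hd₀ hd (f i) (hf i) hi⟩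

/-- The covering hypothesis for a composite of coverings: degrees multiply. -/
theorem map_comp_eq_smul {S'' : Type*} [MeasurableSpace S''] (μ : Measure S) (μ' : Measure S')
    (μ'' : Measure S'') (π : S' → S) (π' : S'' → S') (hπ : Measurable π) (hπ' : Measurable π')
    (d d' : ℕ) (hd : Measure.map π μ' = (d : ℝ≥0∞) • μ)
    (hd' : Measure.map π' μ'' = (d' : ℝ≥0∞) • μ') :
    Measure.map (π ∘ π') μ'' = ((d * d' : ℕ) : ℝ≥0∞) • μ := by
  rw [← Measure.map_map hπ hπ', hd', Measure.map_smul, hd, smul_smul, Nat.cast_mul, mul_comm]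

/-- The total volume of the covering is `d` times the total volume. -/
theorem measure_univ_eq_smul (μ : Measure S) (μ' : Measure S') (π : S' → S)
    (hπ : AEMeasurable π μ') (d : ℕ) (hd : Measure.map π μ' = (d : ℝ≥0∞) • μ) :
    μ' Set.univ = (d : ℝ≥0∞) * μ Set.univ := by
  have := congrArg (fun ν : Measure S => ν Set.univ) hd
  simp only [Measure.smul_apply, smul_eq_mul] at this
  rw [← this, Measure.map_apply_of_aemeasurable hπ MeasurableSet.univ, Set.preimage_univ]

end Summit.Ventures.HodgeRepro2.T5CoveringIntegral
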